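import Summits.AnomalousDissipation.AnomalousDissipation.Theorems.BaireTransferRobustLoudUpgradeLine
import Summits.AnomalousDissipation.AnomalousDissipation.Theorems.BaireTransferRobustLoudUpgradeStubSteadyPersist
import Summits.AnomalousDissipation.AnomalousDissipation.Theorems.BaireTransferRobustLoudUpgradeStubPeriodicWindow
import Summits.AnomalousDissipation.AnomalousDissipation.Theorems.BaireTransferRobustLoudUpgradePeriodicPersistOfHenry
import Literature.Analysis.FluidPDE.PeriodicNSOrbitPersistsProofs
import Literature.Analysis.FluidPDE.LongTimeAverageNonneg
import Summits.AnomalousDissipation.AnomalousDissipation.Theorems.BaireTransferRobustLoudUpgradeStubWindowExhaust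
import Summits.AnomalousDissipation.AnomalousDissipation.Theorems.BaireTransferRobustLoudUpgradeStubOrbitInW
import Summits.AnomalousDissipation.AnomalousDissipation.Theorems.BaireTransferRobustLoudUpgradeStubLimitEquation
import Summits.AnomalousDissipation.AnomalousDissipation.Theorems.BaireTransferRobustLoudUpgradeStubRealizeTempered
import Summits.AnomalousDissipation.AnomalousDissipation.Theorems.BaireTransferRobustLoudUpgradeStubBudgetLimit

/-!
# Lattice-tempered windows of the loud set are CLOSED, and the loud set is `F_σ`
# (crux `BaireTransfer.RobustLoudUpgrade`, stmt-AnomalousDissipation-1144; line `malkin-cone-group-orbits`, lead c16)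

The crux-strategist's census v3 (`Cruxes/RobustLoudUpgrade/STRATEGY-CENSUS.md` §D5) reduces the crux `RobustLoudUpgrade` to
`TemperedClosed → WindowExhaust → LocallyNonMeagreLoud → RobustLoudUpgrade` (+ converse in the Baire space `P_S`), pricing Sub₁
`TemperedClosed` at L/XL for windows cut by pointwise `C¹ₓ` bounds (a quantitative parabolic ladder under the tree's jointly-`C^∞`
classical notion).  This file proves Sub₁ and Sub₀ UNCONDITIONALLY for windows cut on the SPACE–TIME FOURIER LATTICE `ℤ × ℤ³` of the
orbit (`û(n,k) = 𝓕(timeRoll τ u − ∫u(0))(n,k)`, the data of `Literature/Analysis/FluidPDE/TimePeriodicNSLatticeOrbit.lean`):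

  `LW(S; ν₁,ν₂,τ₁,τ₂,H; E,ε) = {c ∈ P_S | ∃ ν ∈ [ν₁,ν₂], τ ∈ [τ₁,τ₂], (u,p) classical τ-periodic solution of NS_ν(f_c) on ℝ × T³,
     ‖∫u(0)‖ ≤ H, Σ_{(n,k)} Λ(n,k)³ ‖û(n,k)‖² ≤ H, meanEnergy u ≤ E, ε ≤ meanDissipation ν u}`,   `Λ(n,k) = |n| + |k|²`.

* `isClosed_latticeWindow` — **`LW` is closed** for `0 < ν₁`, `0 < τ₁` (any `S, H, E, ε`).  Proof = the tree's persistence machinery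
  (`PeriodicNSOrbitPersistsProofs.persists_main`, Iooss 1972 / Henry 1981 / Kielhöfer 2012 on the Fourier side) run as a COMPACTNESS
  argument: along `cᵢ → c` the orbit states `xᵢ = Λûᵢ` lie in the compact set `{Σ Λ‖x‖² ≤ H}` of the state space `W`
  (`isCompact_wt_le`, lattice Rellich), so a subsequence converges IN NORM together with viscosities, periods and means; the projected
  lattice equation passes to the limit mode by mode (`Tempered.stub_limitEquation`); the symbol lower bound + parabolic bootstrap +
  realization (`Tempered.stub_realizeTempered`) return a CLASSICAL periodic orbit of `f_c` whose lattice data is the limit state; the moment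
  passes by closedness of the compact set and the budgets by the slice `H¹` bound (`Tempered.stub_budgetLimit`).
* `loud_eq_iUnion_latticeWindow`, `exists_isClosed_iUnion_eq_loud` — **the loud set `loud S a E ε` (`0 < a`) is `F_σ`**: it is the
  countable union of the closed standard windows `ν ∈ [a/(n+2), a(n+1)/(n+2)]`, `τ ∈ [1/(n+1), n+1]`, `H = n+1`
  (exhaustion = `Tempered.stub_windowExhaust`, p161161: the lattice data of a classical periodic orbit is rapidly decaying).

Consequences (category of the loud set for ALL witnesses, the crux ⟺ local non-meagreness, the route-level door R5) are drawn in the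
sequel `…RobustLoudUpgradeLoudCategory.lean`.

References: G. Iooss, Arch. Rational Mech. Anal. 47 (1972); D. Henry, LNM 840 (1981) Ch. 8; H. Kielhöfer, *Bifurcation Theory* (2012)
§I.8; the tree files `Literature/Analysis/FluidPDE/TimePeriodicNSLattice*.lean`, `PeriodicNSOrbitPersistsProofs.lean`.
-/

set_option linter.dupNamespace false

noncomputable section

open scoped BigOperators Topology ENNReal NNReal ComplexConjugate
open Filter Set Function TopologicalSpace MeasureTheory UnitAddTorus

namespace Summit.AnomalousDissipation.AnomalousDissipation.Theorems.RobustLoudUpgrade.Tempered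

open Literature.Analysis.FunctionSpaces Literature.Analysis.FunctionSpaces.Torus
open Literature.Analysis.FunctionSpaces.EuclideanSpace
open Literature.Analysis.FluidPDE Literature.Analysis.FluidPDE.ScalarFourier
open Literature.Analysis.FluidPDE.TimePeriodicLattice
open Summit.AnomalousDissipation.AnomalousDissipation.Theses.BaireTransfer
open Summit.AnomalousDissipation.AnomalousDissipation.Theorems.RobustLoudUpgrade

-- NOTATION START (verbatim the local notations of `Literature/Analysis/FluidPDE/PeriodicNSOrbitPersistsProofs.lean`)
/-- The flat unit torus `T³`. -/
local notation "𝕋³" => UnitAddTorus (Fin 3)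
/-- Real velocity values. -/
local notation "ℝ³" => EuclideanSpace ℝ (Fin 3)
/-- Complex coefficient values. -/
local notation "ℂ³" => EuclideanSpace ℂ (Fin 3)

/-- Local notation: the parabolic weight `Λ(n, k) = |n| + |k|²`. -/
local notation:max "Λ" m:max => (|((Prod.fst m : ℤ) : ℝ)| + freqNormSq (Prod.snd m))

/-- Local notation: the convective symbol on `ℤ × ℤ³` (as in `TimePeriodicNSLattice`). -/
local notation:max "𝐍[" a ", " b "]" m:max =>
  (WithLp.toLp 2 (fun p : Fin 3 => ∑ j : Fin 3, ∑' m' : ℤ × (Fin 3 → ℤ),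
    a m' j * (dsym j (Prod.snd m - Prod.snd m') * b (m - m') p)) : EuclideanSpace ℂ (Fin 3))

/-- Local notation: division by the weight. -/
local notation:max "𝐜" x:max => (fun mm : ℤ × (Fin 3 → ℤ) =>
  ((((|((Prod.fst mm : ℤ) : ℝ)| + freqNormSq (Prod.snd mm))⁻¹ : ℝ) : ℂ) • x mm))

/-- Local notation: multiplication by the weight. -/
local notation:max "𝐬" x:max => (fun mm : ℤ × (Fin 3 → ℤ) =>
  ((((|((Prod.fst mm : ℤ) : ℝ)| + freqNormSq (Prod.snd mm)) : ℝ) : ℂ) • x mm))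

/-- Local notation: the family of coefficients of `x ∈ W ⊂ ℓ²`. -/
local notation:max "𝐰" x:max =>
  (((x : lp (fun _ : ℤ × (Fin 3 → ℤ) => EuclideanSpace ℂ (Fin 3)) 2)) : ℤ × (Fin 3 → ℤ) → EuclideanSpace ℂ (Fin 3))

/-- Local notation: the symbol `σ_om(n,k) = 2πi om n + 4π²ν|k|² + 2πi m₀·k`. -/
local notation "σ[" om ", " ν ", " m₀ "]" => (fun mm : ℤ × (Fin 3 → ℤ) =>
  2 * Real.pi * Complex.I * ((om : ℝ) : ℂ) * ((Prod.fst mm : ℤ) : ℂ) +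
    (((4 * Real.pi ^ 2 * ν * freqNormSq (Prod.snd mm) : ℝ)) : ℂ) +
    2 * Real.pi * Complex.I * (∑ jj : Fin 3, ((m₀ jj : ℝ) : ℂ) * (((Prod.snd mm) jj : ℤ) : ℂ)))

/-- Local notation: the lattice family of the orbit `u` with period `τ`:
`û(n,k) = 𝓕(complexify ∘ (timeRoll τ u − ∫ u(0)))(n,k)`. -/
local notation:max "𝐨[" τ ", " u "]" => (fun mm : ℤ × (Fin 3 → ℤ) =>
  mFourierCoeff (EuclideanSpace.complexify ∘ fun y : UnitAddTorus (Fin 4) => Torus.timeRoll τ u y - ∫ x, u 0 x)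
    (Fin.cons (Prod.fst mm) (Prod.snd mm) : Fin 4 → ℤ))

/-- Local notation: the force family `y_F(n,k) = [k ≠ 0][n = 0] 𝓕(complexify ∘ F)(k)`. -/
local notation:max "𝐲" F:max => (fun mm : ℤ × (Fin 3 → ℤ) =>
  (ite (Prod.snd mm = 0) (0 : EuclideanSpace ℂ (Fin 3))
    (ite (Prod.fst mm = 0) (mFourierCoeff (EuclideanSpace.complexify ∘ F) (Prod.snd mm)) 0)))
-- NOTATION END

/-! ## §1 Weight bookkeeping -/

section Closed

/-- Termwise weight bookkeeping: `Λ³ ‖v/Λ‖² = Λ ‖v‖²` off the zero spatial modes, and both vanish on them when `v` does. [folklore] -/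
theorem moment_cw_term (v : ℤ × (Fin 3 → ℤ) → ℂ³) (hv : ∀ n : ℤ, v (n, 0) = 0) (m : ℤ × (Fin 3 → ℤ)) :
    ENNReal.ofReal ((Λ m) ^ 3) * ‖(𝐜 v) m‖ₑ ^ 2 = ENNReal.ofReal (Λ m) * ‖v m‖ₑ ^ 2 := by
  by_cases hm : m.2 = 0
  · have : v m = 0 := by
      have := hv m.1; rwa [show ((m.1, 0) : ℤ × (Fin 3 → ℤ)) = m from Prod.ext rfl hm.symm] at this
    simp only [this, smul_zero, enorm_zero, ne_eq, OfNat.ofNat_ne_zero, not_false_eq_true, zero_pow, mul_zero]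
  · have hL : 0 < Λ m := wt_pos hm
    change ENNReal.ofReal ((Λ m) ^ 3) * ‖((((Λ m)⁻¹ : ℝ)) : ℂ) • v m‖ₑ ^ 2 = _
    rw [enorm_smul, mul_pow, ← ofReal_norm, Complex.norm_real, Real.norm_of_nonneg (inv_nonneg.2 hL.le),
      ← ENNReal.ofReal_pow (inv_nonneg.2 hL.le), ← mul_assoc, ← ENNReal.ofReal_mul (by positivity)]
    congr 2
    field_simp

/-- The Λ³-moment of `v/Λ` is the Λ-moment of `v` (families vanishing on the zero spatial modes). [folklore] -/
theorem moment_cw (v : ℤ × (Fin 3 → ℤ) → ℂ³) (hv : ∀ n : ℤ, v (n, 0) = 0) :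
    (∑' m : ℤ × (Fin 3 → ℤ), ENNReal.ofReal ((Λ m) ^ 3) * ‖(𝐜 v) m‖ₑ ^ 2) =
      ∑' m : ℤ × (Fin 3 → ℤ), ENNReal.ofReal (Λ m) * ‖v m‖ₑ ^ 2 :=
  tsum_congr fun m => moment_cw_term v hv m

/-- **LATTICE-TEMPERED WINDOWS ARE CLOSED** (Sub₁ `TemperedClosed` of census D5 for lattice-tempered windows; the registered
stub `stub_temperedClosed` of skeleton c16 is this theorem read through the skeleton's `loudWin`; lead's assembly of the four landed
stubs `stub_orbitInW` p161083, `stub_limitEquation` p161385, `stub_realizeTempered` p161460, `stub_budgetLimit` p161396): for a sequence `cᵢ → c` in the window extract convergent viscosities, periods, means (compact intervals/ball) and a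
NORM-convergent subsequence of the states `xᵢ = Λûᵢ ∈ W` (`isCompact_wt_le`: the window's moment bound is `Σ Λ‖xᵢ‖² ≤ H`);
pass the lattice equation to the limit (`stub_limitEquation`), realize the limit as a classical periodic orbit of `f_c` with the limit
lattice data (`stub_realizeTempered`), and read off window membership (moment by closedness of the compact set, budgets by
`stub_budgetLimit`). [folklore] -/
theorem isClosed_latticeWindow : ∀ (S : Finset (Fin 3 → ℤ)) (ν₁ ν₂ τ₁ τ₂ H E ε : ℝ), 0 < ν₁ → 0 < τ₁ →
    IsClosed {c : Coeff S | ∃ ν : ℝ, ν₁ ≤ ν ∧ ν ≤ ν₂ ∧ ∃ (τ : ℝ) (u : ℝ → 𝕋³ → ℝ³) (p : ℝ → 𝕋³ → ℝ), τ₁ ≤ τ ∧ τ ≤ τ₂ ∧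
      IsClassicalNSSolutionOn Set.univ ν (fun _ => force S c) u p ∧ Function.Periodic u τ ∧
      ‖∫ x, u 0 x‖ ≤ H ∧
      (∑' m : ℤ × (Fin 3 → ℤ), ENNReal.ofReal ((Λ m) ^ 3) * ‖𝐨[τ, u] m‖ₑ ^ 2) ≤ ENNReal.ofReal H ∧
      meanEnergy u ≤ E ∧ ε ≤ meanDissipation ν u} := by
  intro S ν₁ ν₂ τ₁ τ₂ H E ε hν₁ hτ₁
  refine IsSeqClosed.isClosed fun cs cl hmem hcl => ?_
  -- data of the sequence
  choose ν hν₁' hν₂' τ u p hτ₁' hτ₂' hsol hper hmn hmom hE hε using hmem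
  have hν : ∀ i, 0 < ν i := fun i => hν₁.trans_le (hν₁' i)
  have hτ : ∀ i, 0 < τ i := fun i => hτ₁.trans_le (hτ₁' i)
  -- the state space and the states of the orbits
  obtain ⟨W, hW, hWc⟩ := exists_space
  choose x₀ hx₀ heq₀ using fun i => stub_orbitInW hW (cs i) (hτ i) (hsol i) (hper i)
  have hzero : ∀ i (n : ℤ), 𝐨[τ i, u i] (n, 0) = 0 := fun i n =>
    orbit_zero_modes (hsol i) (hper i) (SteadyPersist.hasZeroMean_force' _) n
  have hcx : ∀ i, 𝐜 (𝐰 (x₀ i)) = 𝐨[τ i, u i] := fun i => by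
    rw [hx₀ i]; exact cw_sw (x := 𝐨[τ i, u i]) (hzero i)
  -- the compact set of states and the compact product of parameters
  set Kw : Set W := {z : W | ∑' m, ENNReal.ofReal (Λ m) * ‖(𝐰 z) m‖ₑ ^ 2 ≤ ENNReal.ofReal H} with hKw
  have hKwc : IsCompact Kw := isCompact_wt_le hW hWc ENNReal.ofReal_ne_top
  have hxKw : ∀ i, x₀ i ∈ Kw := by
    intro i
    change ∑' m, ENNReal.ofReal (Λ m) * ‖(𝐰 (x₀ i)) m‖ₑ ^ 2 ≤ ENNReal.ofReal H
    rw [← moment_cw (𝐰 (x₀ i)) (W_zero hW (x₀ i)), hcx i]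
    exact hmom i
  set K : Set ((ℝ × ℝ) × (ℝ³ × W)) := (Icc ν₁ ν₂ ×ˢ Icc τ₁ τ₂) ×ˢ (Metric.closedBall (0 : ℝ³) H ×ˢ Kw) with hK
  have hKc : IsCompact K :=
    (isCompact_Icc.prod isCompact_Icc).prod ((isCompact_closedBall _ _).prod hKwc)
  set z : ℕ → (ℝ × ℝ) × (ℝ³ × W) := fun i => ((ν i, τ i), (∫ y, u i 0 y, x₀ i)) with hz
  have hzK : ∀ i, z i ∈ K := fun i =>
    ⟨⟨⟨hν₁' i, hν₂' i⟩, ⟨hτ₁' i, hτ₂' i⟩⟩, ⟨by simpa only [Metric.mem_closedBall, dist_zero_right] using hmn i, hxKw i⟩⟩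
  obtain ⟨⟨⟨νl, τl⟩, ⟨ml, xl⟩⟩, hlK, φ, hφ, hlim⟩ := hKc.tendsto_subseq hzK
  obtain ⟨⟨⟨hνl₁, hνl₂⟩, ⟨hτl₁, hτl₂⟩⟩, ⟨hmlH, hxlK⟩⟩ := hlK
  rw [Metric.mem_closedBall, dist_zero_right] at hmlH
  have hνl : 0 < νl := hν₁.trans_le hνl₁
  have hτl : 0 < τl := hτ₁.trans_le hτl₁
  -- component limits
  have hνlim : Tendsto (fun i => ν (φ i)) atTop (𝓝 νl) :=
    (continuous_fst.tendsto _).comp ((continuous_fst.tendsto _).comp hlim)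
  have hτlim : Tendsto (fun i => τ (φ i)) atTop (𝓝 τl) :=
    (continuous_snd.tendsto _).comp ((continuous_fst.tendsto _).comp hlim)
  have hmlim : Tendsto (fun i => ∫ y, u (φ i) 0 y) atTop (𝓝 ml) :=
    (continuous_fst.tendsto _).comp ((continuous_snd.tendsto _).comp hlim)
  have hxlim : Tendsto (fun i => x₀ (φ i)) atTop (𝓝 xl) :=
    (continuous_snd.tendsto _).comp ((continuous_snd.tendsto _).comp hlim)
  have homlim : Tendsto (fun i => (τ (φ i))⁻¹) atTop (𝓝 τl⁻¹) := hτlim.inv₀ hτl.ne'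
  have hclim : Tendsto (fun i => cs (φ i)) atTop (𝓝 cl) := hcl.comp hφ.tendsto_atTop
  -- the lattice equation along the subsequence, and in the limit
  have heqs : ∀ i : ℕ, ∀ m : ℤ × (Fin 3 → ℤ), m.2 ≠ 0 →
      σ[(τ (φ i))⁻¹, ν (φ i), ∫ y, u (φ i) 0 y] m • (𝐜 (𝐰 (x₀ (φ i)))) m +
        Torus.lerayCoeff m.2 (𝐍[𝐜 (𝐰 (x₀ (φ i))), 𝐜 (𝐰 (x₀ (φ i)))] m) = (𝐲 (force S (cs (φ i)))) m := by
    intro i m hm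
    rw [hcx (φ i)]
    exact heq₀ (φ i) m hm
  have heql := stub_limitEquation hW (fun i => x₀ (φ i)) xl hxlim (fun i => (τ (φ i))⁻¹) (fun i => ν (φ i))
    τl⁻¹ νl homlim hνlim (fun i => ∫ y, u (φ i) 0 y) ml hmlim (fun i => cs (φ i)) cl hclim heqs
  -- realization of the limit state
  obtain ⟨ul, pl, hsoll, hperl, hmeanl, hdatal⟩ :=
    stub_realizeTempered hW cl xl (inv_pos.2 hτl) hνl ml heql
  simp only [inv_inv] at hperl hdatal
  -- budgets of the realized orbit
  have hmlim' : Tendsto (fun i => ∫ y, u (φ i) 0 y) atTop (𝓝 (∫ y, ul 0 y)) := by rw [hmeanl]; exact hmlim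
  obtain ⟨hEl, hεl⟩ := stub_budgetLimit hW hτl hνl hsoll.smooth_velocity hperl xl hdatal
    (fun i => τ (φ i)) (fun i => ν (φ i)) (fun i => hτ (φ i)) (fun i => hν (φ i)) hνlim
    (fun i => u (φ i)) (fun i => (hsol (φ i)).smooth_velocity) (fun i => hper (φ i))
    (fun i => x₀ (φ i)) (fun i => (hcx (φ i)).symm) hxlim hmlim' (fun i => hE (φ i)) (fun i => hε (φ i))
  -- window membership of the limit
  refine ⟨νl, hνl₁, hνl₂, τl, ul, pl, hτl₁, hτl₂, hsoll, hperl, ?_, ?_, hEl, hεl⟩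
  · rw [hmeanl]; exact hmlH
  · rw [hdatal, moment_cw (𝐰 xl) (W_zero hW xl)]
    exact hxlK

end Closed

/-! ## §3 Sub₀ + Sub₁: the loud set is the countable union of its closed standard lattice windows (`F_σ`) -/

/-- **The loud set is exhausted by, and equal to the union of, its standard lattice-tempered windows** (`0 < a`):
window `n` has `ν ∈ [a/(n+2), a(n+1)/(n+2)]`, `τ ∈ [1/(n+1), n+1]`, mean and Λ³-moment bounded by `n+1`. [folklore] -/
theorem loud_eq_iUnion_latticeWindow (S : Finset (Fin 3 → ℤ)) {a : ℝ} (E ε : ℝ) (ha : 0 < a) :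
    loud S a E ε = ⋃ n : ℕ, {c : Coeff S | ∃ ν : ℝ, a / ((n : ℝ) + 2) ≤ ν ∧ ν ≤ a * ((n : ℝ) + 1) / ((n : ℝ) + 2) ∧
      ∃ (τ : ℝ) (u : ℝ → 𝕋³ → ℝ³) (p : ℝ → 𝕋³ → ℝ), 1 / ((n : ℝ) + 1) ≤ τ ∧ τ ≤ (n : ℝ) + 1 ∧
      IsClassicalNSSolutionOn Set.univ ν (fun _ => force S c) u p ∧ Function.Periodic u τ ∧
      ‖∫ x, u 0 x‖ ≤ (n : ℝ) + 1 ∧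
      (∑' m : ℤ × (Fin 3 → ℤ), ENNReal.ofReal ((Λ m) ^ 3) * ‖𝐨[τ, u] m‖ₑ ^ 2) ≤ ENNReal.ofReal ((n : ℝ) + 1) ∧
      meanEnergy u ≤ E ∧ ε ≤ meanDissipation ν u} := by
  refine Set.Subset.antisymm ?_ (Set.iUnion_subset fun n => ?_)
  · rintro c ⟨ν, hν, hνa, τ, u, p, hτ, hsol, hper, hE, hε⟩
    obtain ⟨n, h1, h2, h3, h4, h5, h6⟩ := stub_windowExhaust S a c ν τ u p hν hνa hτ hsol hper
    exact Set.mem_iUnion.2 ⟨n, ν, h1, h2, τ, u, p, h3, h4, hsol, hper, h5, h6, hE, hε⟩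
  · rintro c ⟨ν, hν₁, hν₂, τ, u, p, hτ₁, _hτ₂, hsol, hper, _hm, _hH, hE, hε⟩
    have hn2 : (0 : ℝ) < (n : ℝ) + 2 := by positivity
    have hn1 : (0 : ℝ) < (n : ℝ) + 1 := by positivity
    refine ⟨ν, ?_, ?_, τ, u, p, ?_, hsol, hper, hE, hε⟩
    · exact lt_of_lt_of_le (div_pos ha hn2) hν₁
    · have : a * ((n : ℝ) + 1) / ((n : ℝ) + 2) < a := by
        rw [div_lt_iff₀ hn2]; nlinarith
      exact lt_of_le_of_lt hν₂ this
    · exact lt_of_lt_of_le (one_div_pos.2 hn1) hτ₁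

/-- **THE LOUD SET IS `F_σ`**: for every finite family `S`, ceiling `a > 0` and budgets `E, ε`, the loud set `loud S a E ε` —
coefficient vectors whose steady trig-poly force carries, at some `ν ∈ (0,a)`, a time-periodic classical Navier–Stokes solution with
`meanEnergy ≤ E`, `meanDissipation ≥ ε` — is a countable union of CLOSED subsets of `P_S` (the c4 hypothesis of
`CategoryTransfer.category_transfer`, now a theorem for all witnesses, steady or genuinely periodic, of any mean). [folklore] -/
theorem exists_isClosed_iUnion_eq_loud : ∀ (S : Finset (Fin 3 → ℤ)) (a E ε : ℝ), 0 < a →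
    ∃ K : ℕ → Set (Coeff S), (∀ n, IsClosed (K n)) ∧ loud S a E ε = ⋃ n, K n := by
  intro S a E ε ha
  refine ⟨_, fun n => ?_, loud_eq_iUnion_latticeWindow S E ε ha⟩
  exact isClosed_latticeWindow S _ _ _ _ _ _ _ (div_pos ha (by positivity)) (one_div_pos.2 (by positivity))

end Summit.AnomalousDissipation.AnomalousDissipation.Theorems.RobustLoudUpgrade.Tempered

end
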